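/-
Copyright (c) 2026 the pub-hodgecm-mathlib formalisation cell (harness21).  Prover seat hodgecm-mathlib-K2E1-p15 (g0), Track B ∕ K2-LIT «5Res», h413 = `stmt-HodgeConjecture-24833`,
line `K2_E1_TraceFormulaBeta`, route of record `HCCMUnconditional`; dealer K2E1-plan (g7) deal G5 (14:01:36Z): the `hB` letter, LEVEL-∕τ-GENERIC, from per-point continued truncated
families shaped as ★ p860657∕p860668's outputs (one countable exceptional set), with the M1 package ★ p860705 recovered as a corollary.
-/
import Summits.HodgeConjecture.HodgeConjecture.Theorems.K2E1ChiScatteringStripBoundM1CMTwo       -- ★ p860603 (this seat): `norm_le_of_truncatedFamily_selfDual_quadrant`, `hB_of_hB_off_exceptional`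
import Summits.HodgeConjecture.HodgeConjecture.Theorems.K2E1ChiEisensteinPerPointFamilyM1CMTwo    -- ★ p860705 (this seat): the M1 per-point package (+ ★ p860657: `exists_seq_tendsto_of_countable`)
import HarnessLib

/-!
# K2·E1 — `K2E1ChiScatteringStripBoundLevelCMTwo`: THE `hB` LETTER FROM PER-POINT CONTINUED TRUNCATED FAMILIES OFF ONE COUNTABLE SET — LEVEL- AND `τ`-GENERIC; the M1
# package as a corollary (`U(1,1)_{L∕L⁺}`)

Track B ∕ K2-LIT, crux h413 = `stmt-HodgeConjecture-24833`; cell `hodgecm-mathlib`, squad K2, ENGINE E1; dealer K2E1-plan (g7) G5 14:01:36Z.  THEOREMS ONLY (no `def`, no `instance`, no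
notation, no named-fact hypothesis, no `sorry`); lane `--kind proof --supports stmt-HodgeConjecture-24833 --as helper` (count-neutral).  Closes no socket.

WHAT ([MoeglinWaldspurger1995, IV.2.3, IV.3.12 (a)]).  ★ p860603 derives the consumer's `hB` (★ `K2E1PseudoEisensteinContourShiftVector` :193) from per-point self-dual data AT EVERY `z` of the
half-strip; the per-ball exports (★ (α), any level∕`τ`) reach every point only OFF a countable set `S ⊇ P` (★ p860657∕p860705 shape).  This file closes the gap generically: INPUT, per
test index `a`, the per-point datum off `S` at one level `T ≥ 1` for the section `sec a` (exactly the conclusion clauses of ★ `exists_perPoint_truncatedFamily'`), the self-dual relation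
`h4 a` at level `T`, the scattering operator `M : ℂ → V →ₗ V` holomorphic off `P` on each `φ a`, and the continuity of the entries on the half-strip (★ (d): no pole there);
OUTPUT `∃ B, hB`.  Nothing refers to a level or a `K_∞`-type.  §2 recovers the M1 package (★ p860705) by `obtain` + `exact` (sanity check of the binder shapes).
* §1 **`hB_of_perPoint_families_off_countable`** · §2 **`hB_maximalLevel_of_selfDual_letters`** (M1: ★ p860705 ∘ §1).

HONEST LABEL: HC_CM is proved only modulo the 7 printed citations (2 remaining named inputs: hLiu418 = `stmt-HodgeConjecture-24832`, h413 = `stmt-HodgeConjecture-24833`) until rung 0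
closes; this file asserts no named fact, is conditional on its letters (`h4`, the per-point data, continuity of the entries), and closes no socket.

## References
* [MoeglinWaldspurger1995] C. Mœglin, J.-L. Waldspurger, *Spectral decomposition and Eisenstein series* (1995), IV.2.3, IV.3.12 (a).
* [Arthur1980TraceFormulaII] J. Arthur, *A trace formula for reductive groups II*, Compositio Math. 40 (1980), §4.
-/

set_option autoImplicit false
set_option linter.dupNamespace false  -- the mandated namespace repeats the summit's segment (`HodgeConjecture.HodgeConjecture`)

noncomputable section

open MeasureTheory Measure Filter Topology Set NumberField IsDedekindDomain Metric
open scoped NNReal ENNReal ComplexConjugate InnerProductSpace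
open Literature.MeasureTheory.Group Literature.NumberTheory Literature.NumberTheory.Automorphic Literature.NumberTheory.Automorphic.UnitaryGroup AdelicGroupData
open Literature.NumberTheory.GaloisRepresentations (HeckeCharacter)
open Summit.HodgeConjecture.HodgeConjecture.Cruxes.H413.K2E1BorelEisensteinU
open Summit.HodgeConjecture.HodgeConjecture.Cruxes.H413.K2E1BLBorelSpacesU2Defs
open Summit.HodgeConjecture.HodgeConjecture.Cruxes.H413.K2E1BLBorelOperatorsU2Defs
open Summit.HodgeConjecture.HodgeConjecture.Cruxes.H413.K2E1CharacterEisensteinU2Defs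
open Summit.HodgeConjecture.HodgeConjecture.Cruxes.H413.K2E1ChiSectionSpaceU2Defs
open Summit.HodgeConjecture.HodgeConjecture.Cruxes.H413.K2E1ChiScatteringStripBoundM1CMTwo (norm_le_of_truncatedFamily_selfDual_quadrant hB_of_hB_off_exceptional)
open Summit.HodgeConjecture.HodgeConjecture.Cruxes.H413.K2E1ChiEisensteinPerPointFamilyCMTwo (exists_seq_tendsto_of_countable)
open Summit.HodgeConjecture.HodgeConjecture.Cruxes.H413.K2E1ChiEisensteinPerPointFamilyM1CMTwo (chiEisenstein_perPoint_family_maximalLevel_cm_two)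

namespace Summit.HodgeConjecture.HodgeConjecture.Cruxes.H413.K2E1ChiScatteringStripBoundLevelCMTwo

variable (L : Type) [Field L] [NumberField L] [IsCMField L]
  [MeasurableSpace (quasiSplit (↥(maximalRealSubfield L)) L (IsCMField.complexConj L) 2).Adelic]
  {V : Type*} [NormedAddCommGroup V] [InnerProductSpace ℂ V]

/-! ## §1 Generic: per-point families off a countable set ⟹ `hB` -/

/-- **`hB` FROM PER-POINT CONTINUED TRUNCATED FAMILIES OFF ONE COUNTABLE SET** (module docstring; level- and `τ`-generic).  Per index `a`: the self-dual relation `h4 a` at level `T` for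
the section `sec a` and the vector `v a ≠ 0` with `ψ_a := fun w => M w (v a)`; the per-point datum off `S` (★ `exists_perPoint_truncatedFamily'`'s conclusion clauses, with `D₁ ⊆ Pᶜ`);
`M · (v a)` holomorphic off `P`; the entries continuous on the half-strip.  THEN `∃ B, ∀ a b z, ½ < Re z → Re z ≤ σ₀ → 1 ≤ |Im z| → ‖⟪v′ b, M z (v a)⟫‖ ≤ B`.
[cite: MoeglinWaldspurger1995, IV.2.3, IV.3.12 (a)] [cite: Arthur1980TraceFormulaII, §4] -/
theorem hB_of_perPoint_families_off_countable
    (μ : Measure (quasiSplit (↥(maximalRealSubfield L)) L (IsCMField.complexConj L) 2).automorphicQuotient)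
    (ν : Measure ↥(adelicUnipotent (↥(maximalRealSubfield L)) L (IsCMField.complexConj L) 2)) (𝓕 : Set ↥(adelicUnipotent (↥(maximalRealSubfield L)) L (IsCMField.complexConj L) 2))
    {T : ℝ≥0} (hT : 1 ≤ T) {cμ K κ m : ℝ} (hcμ : 0 < cμ) (hK : 0 < K) (hκ : 0 < κ) (hm : 0 < m) (σ₀ : ℝ)
    {P S : Set ℂ} (hSc : S.Countable)
    {α β : Type*} [Fintype α] [Fintype β] (v : α → V) (hv : ∀ a, v a ≠ 0) (v' : β → V) (M : ℂ → V →ₗ[ℂ] V)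
    (hMd : ∀ a, DifferentiableOn ℂ (fun w => M w (v a)) Pᶜ)
    (hcont : ∀ a b, ∀ z : ℂ, 1 / 2 < z.re → z.re ≤ σ₀ → 1 ≤ |z.im| →
      ContinuousWithinAt (fun w => ⟪v' b, M w (v a)⟫_ℂ) {w : ℂ | 1 / 2 < w.re ∧ w.re ≤ σ₀ ∧ 1 ≤ |w.im|} z)
    (sec : α → (quasiSplit (↥(maximalRealSubfield L)) L (IsCMField.complexConj L) 2).Adelic → ℂ)
    (Ec : α → ℂ → (quasiSplit (↥(maximalRealSubfield L)) L (IsCMField.complexConj L) 2).Adelic → ℂ)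
    (hE1 : ∀ a (z : ℂ), 1 < z.re → Ec a z = eisensteinSeriesU (flatSectionU (sec a) z))
    (h4 : ∀ a, ∀ z z' : ℂ, 1 < z'.re → z'.re < z.re →
      ∫ x, (quasiSplit (↥(maximalRealSubfield L)) L (IsCMField.complexConj L) 2).quotFun (truncation ν 𝓕 T (eisensteinSeriesU (flatSectionU (sec a) z))) x *
          conj ((quasiSplit (↥(maximalRealSubfield L)) L (IsCMField.complexConj L) 2).quotFun (truncation ν 𝓕 T (eisensteinSeriesU (flatSectionU (sec a) z'))) x) ∂μ =
      ((cμ : ℝ) : ℂ) * (((K : ℝ) : ℂ) *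
        (((((T : ℝ) : ℝ) : ℂ) ^ (z + conj z' - 1) / (z + conj z' - 1)) * (((κ : ℝ) : ℂ) * (((m : ℝ) : ℂ) * ⟪v a, v a⟫_ℂ))
          + ((((T : ℝ) : ℝ) : ℂ) ^ (z - conj z') / (z - conj z')) * (((κ : ℝ) : ℂ) * (((m : ℝ) : ℂ) * ⟪M z' (v a), v a⟫_ℂ))
          - ((((T : ℝ) : ℝ) : ℂ) ^ (-(z - conj z')) / (z - conj z')) * (((κ : ℝ) : ℂ) * (((m : ℝ) : ℂ) * ⟪v a, M z (v a)⟫_ℂ))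
          - ((((T : ℝ) : ℝ) : ℂ) ^ (-(z + conj z' - 1)) / (z + conj z' - 1)) * (((κ : ℝ) : ℂ) * (((m : ℝ) : ℂ) * ⟪M z' (v a), M z (v a)⟫_ℂ)))))
    (hpt : ∀ a (z : ℂ), 1 / 2 < z.re → z.im ≠ 0 → z ∉ S →
      ∃ (D₁ O₁ O₂' : Set ℂ) (Fam' : ℂ → Lp ℂ 2 μ), IsOpen D₁ ∧ IsPreconnected D₁ ∧
        (D₁ ⊆ {z : ℂ | 1 / 2 < z.re ∧ 0 < z.im} ∨ D₁ ⊆ {z : ℂ | 1 / 2 < z.re ∧ z.im < 0}) ∧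
        IsOpen O₁ ∧ O₁.Nonempty ∧ O₁ ⊆ D₁ ∧ IsOpen O₂' ∧ O₂'.Nonempty ∧ O₂' ⊆ D₁ ∧ (∀ w ∈ O₁, ∀ w' ∈ O₂', 1 < w'.re ∧ w'.re < w.re) ∧ z ∈ D₁ ∧ D₁ ⊆ Pᶜ ∧
        DifferentiableOn ℂ Fam' D₁ ∧
        ∀ w' ∈ D₁, 1 < w'.re → ((Fam' w' : Lp ℂ 2 μ) : (quasiSplit (↥(maximalRealSubfield L)) L (IsCMField.complexConj L) 2).automorphicQuotient → ℂ) =ᵐ[μ]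
          (quasiSplit (↥(maximalRealSubfield L)) L (IsCMField.complexConj L) 2).quotFun (truncation ν 𝓕 T (Ec a w'))) :
    ∃ B : ℝ, ∀ a b, ∀ z : ℂ, 1 / 2 < z.re → z.re ≤ σ₀ → 1 ≤ |z.im| → ‖⟪v' b, M z (v a)⟫_ℂ‖ ≤ B := by
  classical
  set C : ℝ := (σ₀ - 1 / 2) * (T : ℝ) ^ (2 * (σ₀ - 1 / 2)) + Real.sqrt ((σ₀ - 1 / 2) ^ 2 * (T : ℝ) ^ (4 * (σ₀ - 1 / 2)) + (T : ℝ) ^ (4 * (σ₀ - 1 / 2))) with hC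
  refine ⟨(∑ b, ‖v' b‖) * (|C| * ∑ a, ‖v a‖), ?_⟩
  -- the bound off `S`
  have hoff : ∀ a b, ∀ z : ℂ, 1 / 2 < z.re → z.re ≤ σ₀ → 1 ≤ |z.im| → z ∉ S → ‖⟪v' b, M z (v a)⟫_ℂ‖ ≤ (∑ b, ‖v' b‖) * (|C| * ∑ a, ‖v a‖) := by
    intro a b z hz₁ hz₂ ht hzS
    have hzim : z.im ≠ 0 := fun h => by rw [h, abs_zero] at ht; linarith
    obtain ⟨D₁, O₁, O₂', Fam', hD₁, hD₁c, hD₁sub, hO₁, hO₁ne, hO₁D, hO₂', hO₂'ne, hO₂'D, hsep, hzD, hDP, hFd, hFtube⟩ := hpt a z hz₁ hzim hzS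
    have hψ : DifferentiableOn ℂ (fun w => M w (v a)) D₁ := (hMd a).mono hDP
    have hFtube' : ∀ w ∈ D₁, 1 < w.re → ((Fam' w : Lp ℂ 2 μ) : (quasiSplit (↥(maximalRealSubfield L)) L (IsCMField.complexConj L) 2).automorphicQuotient → ℂ) =ᵐ[μ]
        (quasiSplit (↥(maximalRealSubfield L)) L (IsCMField.complexConj L) 2).quotFun (truncation ν 𝓕 T (eisensteinSeriesU (flatSectionU (sec a) w))) :=
      fun w hw hw1 => (hE1 a w hw1) ▸ hFtube w hw hw1
    have hMz := norm_le_of_truncatedFamily_selfDual_quadrant L μ ν 𝓕 hT hcμ hK hκ hm (hv a) (sec a) (fun w => M w (v a)) (h4 a) hD₁ hD₁c hD₁sub hO₁ hO₁ne hO₁D hO₂' hO₂'ne hO₂'D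
      hsep hψ Fam' hFd hFtube' σ₀ hzD hz₂ ht
    have hMz' : ‖M z (v a)‖ ≤ |C| * ‖v a‖ := hMz.trans (mul_le_mul_of_nonneg_right (le_abs_self C) (norm_nonneg _))
    calc ‖⟪v' b, M z (v a)⟫_ℂ‖ ≤ ‖v' b‖ * ‖M z (v a)‖ := norm_inner_le_norm _ _
      _ ≤ ‖v' b‖ * (|C| * ‖v a‖) := mul_le_mul_of_nonneg_left hMz' (norm_nonneg _)
      _ ≤ (∑ b, ‖v' b‖) * (|C| * ∑ a, ‖v a‖) := by
          refine mul_le_mul (Finset.single_le_sum (fun b _ => norm_nonneg (v' b)) (Finset.mem_univ b)) ?_ (by positivity) (Finset.sum_nonneg fun b _ => norm_nonneg _)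
          exact mul_le_mul_of_nonneg_left (Finset.single_le_sum (fun a _ => norm_nonneg (v a)) (Finset.mem_univ a)) (abs_nonneg _)
  exact hB_of_hB_off_exceptional v v' M σ₀ S hoff (fun z hz₁ hz₂ ht => exists_seq_tendsto_of_countable hSc hz₁ hz₂ ht) hcont

/-! ## §2 The M1 package recovered (sanity check of the binder shapes) -/

section M1

variable [BorelSpace (quasiSplit (↥(maximalRealSubfield L)) L (IsCMField.complexConj L) 2).Adelic]

/-- **`hB` AT M1 MODULO THE SELF-DUAL LETTERS** — ★ p860705's per-point package ∘ §1: the M1 print's binders VERBATIM ⟹ `∃ q Ec qc P`, (E1)–(E4) VERBATIM, and for all self-dual data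
(`v : α′ → V` non-zero test vectors, `M` holomorphic off `P` on them, entries continuous on the half-strip, `h4` at ANY level `T ≥ 1` for the M1 section `φ`): `∃ B, hB`.
[cite: MoeglinWaldspurger1995, IV.2.3, IV.3.12 (a)] -/
theorem hB_maximalLevel_of_selfDual_letters
    (μ : Measure (quasiSplit (↥(maximalRealSubfield L)) L (IsCMField.complexConj L) 2).automorphicQuotient) [(quasiSplit (↥(maximalRealSubfield L)) L (IsCMField.complexConj L) 2).IsAutomorphicMeasure μ]
    (νG : Measure (quasiSplit (↥(maximalRealSubfield L)) L (IsCMField.complexConj L) 2).Adelic) [νG.IsHaarMeasure] [νG.IsInvInvariant] [SFinite νG]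
    (ν : Measure ↥(adelicUnipotent (↥(maximalRealSubfield L)) L (IsCMField.complexConj L) 2)) [ν.IsHaarMeasure] [ν.IsMulRightInvariant] [ν.IsInvInvariant]
    {𝓕 : Set ↥(adelicUnipotent (↥(maximalRealSubfield L)) L (IsCMField.complexConj L) 2)}
    (h𝓕N : IsFundamentalDomain ↥(rationalUnipotent (↥(maximalRealSubfield L)) L (IsCMField.complexConj L) 2) 𝓕 ν) (h𝓕c : IsCompact (closure 𝓕)) (h𝓕₀ : ν 𝓕 ≠ 0)
    {β : (quasiSplit (↥(maximalRealSubfield L)) L (IsCMField.complexConj L) 2).Adelic → ℝ≥0∞}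
    (hβ : IsCoveringWeight ↥((arithmeticBorel (↥(maximalRealSubfield L)) L (IsCMField.complexConj L) 2).map (quasiSplit (↥(maximalRealSubfield L)) L (IsCMField.complexConj L) 2).arithmeticSubgroup.subtype) β)
    {μZ : Measure (borelQuotient (↥(maximalRealSubfield L)) L (IsCMField.complexConj L) 2)} [SFinite μZ]
    (hμZ : ∀ f : borelQuotient (↥(maximalRealSubfield L)) L (IsCMField.complexConj L) 2 → ℝ≥0∞, Measurable f → ∫⁻ z, f z ∂μZ = ∫⁻ g, β g * f (toBorelQuotient (↥(maximalRealSubfield L)) L (IsCMField.complexConj L) 2 g) ∂νG)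
    -- the M1 family: `φ ∈ V(χ, K, 1)` continuous bounded with `φ ∘ ι_∞ = φ(1)`, and a basis of `V(χʷ, K, 1)` by continuous bounded functions
    {χ : HeckeCharacter L} {φ : (quasiSplit (↥(maximalRealSubfield L)) L (IsCMField.complexConj L) 2).Adelic → ℂ} (hφV : φ ∈ chiSectionSpace χ ((standardMaximalCompactGL 2 L).comap (adelicVal (↥(maximalRealSubfield L)) L (IsCMField.complexConj L) 2 ((StdForm.antidiagonal 2).over L)) : Subgroup (quasiSplit (↥(maximalRealSubfield L)) L (IsCMField.complexConj L) 2).Adelic) (fun _ => 1)) (hφc : Continuous φ) {Mφ : ℝ} (hφM : ∀ x, ‖φ x‖ ≤ Mφ)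
    (hφinf : ∀ a : arch (↥(maximalRealSubfield L)) L (IsCMField.complexConj L) 2 ((StdForm.antidiagonal 2).over L), φ (archToAdelic (↥(maximalRealSubfield L)) L (IsCMField.complexConj L) 2 _ a) = φ 1)
    {ι' : Type} [Fintype ι'] [DecidableEq ι'] (bV : Module.Basis ι' ℂ ↥(chiSectionSpace (reflectChar (IsCMField.complexConj L) χ) ((standardMaximalCompactGL 2 L).comap (adelicVal (↥(maximalRealSubfield L)) L (IsCMField.complexConj L) 2 ((StdForm.antidiagonal 2).over L)) : Subgroup (quasiSplit (↥(maximalRealSubfield L)) L (IsCMField.complexConj L) 2).Adelic) (fun _ => 1)))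
    (hbc : ∀ j, Continuous ((bV j : ↥(chiSectionSpace (reflectChar (IsCMField.complexConj L) χ) ((standardMaximalCompactGL 2 L).comap (adelicVal (↥(maximalRealSubfield L)) L (IsCMField.complexConj L) 2 ((StdForm.antidiagonal 2).over L)) : Subgroup (quasiSplit (↥(maximalRealSubfield L)) L (IsCMField.complexConj L) 2).Adelic) (fun _ => 1))) : (quasiSplit (↥(maximalRealSubfield L)) L (IsCMField.complexConj L) 2).Adelic → ℂ)) {Mb : ℝ} (hbM : ∀ j x, ‖((bV j : ↥(chiSectionSpace (reflectChar (IsCMField.complexConj L) χ) ((standardMaximalCompactGL 2 L).comap (adelicVal (↥(maximalRealSubfield L)) L (IsCMField.complexConj L) 2 ((StdForm.antidiagonal 2).over L)) : Subgroup (quasiSplit (↥(maximalRealSubfield L)) L (IsCMField.complexConj L) 2).Adelic) (fun _ => 1))) : (quasiSplit (↥(maximalRealSubfield L)) L (IsCMField.complexConj L) 2).Adelic → ℂ) x‖ ≤ Mb) :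
    ∃ (q : ι' → ℂ → ℂ) (Ec : ℂ → (quasiSplit (↥(maximalRealSubfield L)) L (IsCMField.complexConj L) 2).Adelic → ℂ) (qc : ι' → ℂ → ℂ) (P : Set ℂ),
      (∀ j, DifferentiableOn ℂ (q j) {z : ℂ | 1 < z.re}) ∧
      (∀ z : ℂ, 1 < z.re → (∑ j, q j z • ((bV j : ↥(chiSectionSpace (reflectChar (IsCMField.complexConj L) χ) ((standardMaximalCompactGL 2 L).comap (adelicVal (↥(maximalRealSubfield L)) L (IsCMField.complexConj L) 2 ((StdForm.antidiagonal 2).over L)) : Subgroup (quasiSplit (↥(maximalRealSubfield L)) L (IsCMField.complexConj L) 2).Adelic) (fun _ => 1))) : (quasiSplit (↥(maximalRealSubfield L)) L (IsCMField.complexConj L) 2).Adelic → ℂ)) = ((((ν 𝓕).toReal⁻¹ : ℝ)) : ℂ) • (fun g : (quasiSplit (↥(maximalRealSubfield L)) L (IsCMField.complexConj L) 2).Adelic => (∫ v : ↥(adelicUnipotent (↥(maximalRealSubfield L)) L (IsCMField.complexConj L) 2), flatSectionU φ z ((quasiSplit (↥(maximalRealSubfield L)) L (IsCMField.complexConj L)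 2).toAdelic (weylLongU ((IsCMField.complexConj L : L ≃ₐ[↥(maximalRealSubfield L)] L) : L →+* L) (rfl : (StdForm.antidiagonal 2).over L = (StdForm.antidiagonal 2).over L)) * ((v : (quasiSplit (↥(maximalRealSubfield L)) L (IsCMField.complexConj L) 2).Adelic) * g)) ∂ν) * (((borelHeight g : ℝ) : ℂ) ^ (z - 1)))) ∧
      (∀ g, MeromorphicNFOn (fun z => Ec z g) univ) ∧ (∀ j, MeromorphicNFOn (qc j) univ) ∧
      (∀ z : ℂ, 1 < z.re → Ec z = eisensteinSeriesU (flatSectionU φ z)) ∧ (∀ j (z : ℂ), 1 < z.re → qc j z = q j z) ∧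
      IsClosed P ∧ (∀ z₀ : ℂ, ∀ᶠ s in 𝓝[≠] z₀, s ∉ P) ∧ (∀ z ∈ P, z.re ≤ 1) ∧
      (∀ g (z : ℂ), z ∉ P → AnalyticAt ℂ (fun z => Ec z g) z) ∧ (∀ j (z : ℂ), z ∉ P → AnalyticAt ℂ (qc j) z) ∧
      (∀ g, DifferentiableOn ℂ (fun z => Ec z g) Pᶜ) ∧ (∀ j, DifferentiableOn ℂ (qc j) Pᶜ) ∧
      (∀ z : ℂ, z ∉ P → Continuous (Ec z)) ∧
      ∀ {V : Type} [NormedAddCommGroup V] [InnerProductSpace ℂ V] {cμ K κ m : ℝ}, 0 < cμ → 0 < K → 0 < κ → 0 < m → ∀ (σ₀ : ℝ) {T : ℝ≥0}, 1 ≤ T →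
        ∀ {α' β' : Type} [Fintype α'] [Fintype β'] (v : α' → V), (∀ a, v a ≠ 0) → ∀ (v' : β' → V) (M : ℂ → V →ₗ[ℂ] V),
        (∀ a, DifferentiableOn ℂ (fun w => M w (v a)) Pᶜ) →
        (∀ a b, ∀ z : ℂ, 1 / 2 < z.re → z.re ≤ σ₀ → 1 ≤ |z.im| →
          ContinuousWithinAt (fun w => ⟪v' b, M w (v a)⟫_ℂ) {w : ℂ | 1 / 2 < w.re ∧ w.re ≤ σ₀ ∧ 1 ≤ |w.im|} z) →
        (∀ a, ∀ z z' : ℂ, 1 < z'.re → z'.re < z.re →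
          ∫ x, (quasiSplit (↥(maximalRealSubfield L)) L (IsCMField.complexConj L) 2).quotFun (truncation ν 𝓕 T (eisensteinSeriesU (flatSectionU φ z))) x *
              conj ((quasiSplit (↥(maximalRealSubfield L)) L (IsCMField.complexConj L) 2).quotFun (truncation ν 𝓕 T (eisensteinSeriesU (flatSectionU φ z'))) x) ∂μ =
          ((cμ : ℝ) : ℂ) * (((K : ℝ) : ℂ) *
            (((((T : ℝ) : ℝ) : ℂ) ^ (z + conj z' - 1) / (z + conj z' - 1)) * (((κ : ℝ) : ℂ) * (((m : ℝ) : ℂ) * ⟪v a, v a⟫_ℂ))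
              + ((((T : ℝ) : ℝ) : ℂ) ^ (z - conj z') / (z - conj z')) * (((κ : ℝ) : ℂ) * (((m : ℝ) : ℂ) * ⟪M z' (v a), v a⟫_ℂ))
              - ((((T : ℝ) : ℝ) : ℂ) ^ (-(z - conj z')) / (z - conj z')) * (((κ : ℝ) : ℂ) * (((m : ℝ) : ℂ) * ⟪v a, M z (v a)⟫_ℂ))
              - ((((T : ℝ) : ℝ) : ℂ) ^ (-(z + conj z' - 1)) / (z + conj z' - 1)) * (((κ : ℝ) : ℂ) * (((m : ℝ) : ℂ) * ⟪M z' (v a), M z (v a)⟫_ℂ))))) →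
        ∃ B : ℝ, ∀ a b, ∀ z : ℂ, 1 / 2 < z.re → z.re ≤ σ₀ → 1 ≤ |z.im| → ‖⟪v' b, M z (v a)⟫_ℂ‖ ≤ B := by
  obtain ⟨q, Ec, qc, P, hq, hqφ, h1, h2, hE1, hqcq, hPc, hPcd, hPre, hEan, hqan, hEdiff, hqdiff, hEcont, S, hSc, -, hpt⟩ :=
    chiEisenstein_perPoint_family_maximalLevel_cm_two L μ νG ν h𝓕N h𝓕c h𝓕₀ hβ hμZ hφV hφc hφM hφinf bV hbc hbM
  refine ⟨q, Ec, qc, P, hq, hqφ, h1, h2, hE1, hqcq, hPc, hPcd, hPre, hEan, hqan, hEdiff, hqdiff, hEcont, ?_⟩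
  intro V _ _ cμ K κ m hcμ hK hκ hm σ₀ T hT α' β' _ _ v hv v' M hMd hcont h4
  exact hB_of_perPoint_families_off_countable L μ ν 𝓕 hT hcμ hK hκ hm σ₀ hSc v hv v' M hMd hcont (fun _ => φ) (fun _ => Ec) (fun _ => hE1) h4
    (fun a z hz₁ hzim hzS => hpt T hT z hz₁ hzim hzS)

end M1

end Summit.HodgeConjecture.HodgeConjecture.Cruxes.H413.K2E1ChiScatteringStripBoundLevelCMTwo

end
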